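import Summits.Ventures.HSemireg.AmplificationChainVersalChart
import HarnessLib

/-!
# Venture HSemireg — route (C)'s Hodge-free algebraisation with the EGA input DISCHARGED: Lieblich-type
# versal charts ALONE ⟹ `PerfectLiftsAlgebraise π` ⟹ `PerfectComplexAlgebraisesLifts C` (EGA-free rung)

HONEST FRAMING. Lean index of the computation cell `pub-hsemireg` (theory seat 3, «algebraisation step»). Nothing
about any explicit variety is asserted; every published input is a hypothesis BY NAME; nothing here says HC, HC_CM
or HC_AV is proved; the g = 4 split case is IN PRINT ([Markman2023GeneralizedKummers] Thm. 1.5 (= Thm. 13.4; J. Eur. Math.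
Soc. 25 (2023) p. 236; pre-publication arXiv numbering: Thm. 1.3)) and is RE-DERIVED modulo the named hypotheses. No definition; theorems only; no `sorry`, no new axiom.

## What this file does

`AmplificationChainVersalChart.lean` proved `PerfectLiftsAlgebraise π` (and p7's `PerfectComplexAlgebraisesLifts C`,
every `C`) from TWO named inputs: Lieblich-type versal charts (`HasVersalPerfectChartAt`, predicate, assumption by
name when asserted; PRECISION (red-5 W-14): its versality clause is typed in EXISTENCE form — implied by, and WEAKER
than, formal smoothness of a Lieblich atlas at the chart point, which nothing on this chain consumes; READING NOTE in
`AmplificationChainVersalChartWitness.lean`) and the Literature named fact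
`Literature.AlgebraicGeometry.Morphisms.EGAIV_etaleQuasiSection_of_liftsSmallExtensions` ([EGAIV4] Prop. 17.14.2 +
Cor. 17.16.3 (i), `ℂ`-scheme special case). That Literature fact is now a THEOREM of the tree:
`Literature.AlgebraicGeometry.Morphisms.EGAIV_etaleQuasiSection_of_liftsSmallExtensions_holds` (seat lit-3: Prop.
17.14.2 from Mathlib's Jacobian criterion `Algebra.FormallySmooth.iff_injective_cotangentComplexBaseChange` and
Artin–Rees; Cor. 17.16.3 (i) = `etaleQuasiSection_of_smooth`). THIS FILE feeds the theorem in, so that the EGA input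
LEAVES the trust base:

* §1 `perfectLiftsAlgebraise_of_hasVersalPerfectChartAt` (PROVED): versal charts alone ⟹ `PerfectLiftsAlgebraise π`
  (`S` locally noetherian).
* §2 `perfectComplexAlgebraisesLifts_of_versalCharts` (PROVED): versal charts on every smooth projective family over a
  smooth base ⟹ `PerfectComplexAlgebraisesLifts C` for EVERY `C`; and the g = 4 σ-row on that trust base
  (`weilFourfoldsSplit_of_reach_of_pridhamPerfect_of_versalCharts_of_complex`, every binder verbatim the
  `…_of_versalCharts_of_EGA_of_complex` row minus `hEGA`).

STATUS WORDS (cell rules F-1 / W-4). After this file the (E)+(C) half of the Monday σ-row reads: «Lieblich-type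
versal charts (assumption by name; seat corollary of [Lieblich2006] Thm. 4.2.1 / Prop. 2.1.9 + smooth atlas +
[StacksProject] 0DNZ + [ThomasonTrobaugh1990] 2.3.1 (d) — NOT one printed sentence; versality typed in EXISTENCE form —
weaker than Lieblich's formal smoothness, which is not consumed (red-5 W-14)) ∧ KERNEL glue ([EGAIV4] 17.14.2 /
17.16.3 (i) PROVED in the tree)». (F) = `PridhamPerfectLifts C` is untouched.

References: [EGAIV4] Publ. Math. IHÉS 32 (1967), Prop. 17.14.2 (p. 98), Cor. 17.16.3 (i) (p. 106) ·
[Lieblich2006] J. Algebraic Geom. 15 (2006), Thm. 4.2.1, Prop. 2.1.9 · [StacksProject] Tag 0DNZ ·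
[ThomasonTrobaugh1990] Prop. 2.3.1 (d) · [Perry2022] Compositio Math. 158 (2022), §7.1 and proof of Prop. 8.1 ·
[Pridham2024Semiregularity] Cor. 2.25, Rem. 2.27 · [Markman2023GeneralizedKummers] Thm. 1.5 (= Thm. 13.4; J. Eur. Math. Soc. 25 (2023) p. 236; pre-publication arXiv numbering: Thm. 1.3) ·
[Deligne1982HodgeCycles] proof of Thm. 4.8.
-/

noncomputable section

open CategoryTheory CategoryTheory.Limits AlgebraicGeometry
open Literature.AlgebraicGeometry.Motives Literature.AlgebraicGeometry.HodgeTheory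
open Literature.AlgebraicGeometry.ModuliOfAbelianVarieties Literature.AlgebraicGeometry.Deligne1982
open Literature.AlgebraicGeometry.KTheory
open Literature.AlgebraicTopology.SingularHomology
open Literature.AlgebraicGeometry.Morphisms (EGAIV_etaleQuasiSection_of_liftsSmallExtensions_holds)

namespace Summit.Ventures.HSemireg

open Summit.HodgeConjecture.HodgeConjecture
open Summit.HodgeConjecture.HodgeConjecture.WeilTypeLadder
open Summit.HodgeConjecture.HodgeConjecture.Cruxes.HodgeAbelianVarieties.EStepSecantInduction

/-! ## §1 Versal charts alone ⟹ the object-level étale shape -/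

section Glue

variable {𝒳 S : SchemeOver ℂ} (π : 𝒳 ⟶ S)

/-- **Derived-liftable perfect complexes with a versal algebraic chart ALGEBRAISE over an étale neighbourhood —
EGA-free form** (PROVED): if every universally gluable bounded complex of vector bundles on a model of a fibre of `π`
(over a locally noetherian base) has a Lieblich-type versal chart (`HasVersalPerfectChartAt`; versality in EXISTENCE
form, weaker than Lieblich's formal smoothness — red-5 W-14), then
`PerfectLiftsAlgebraise π`. This is `perfectLiftsAlgebraise_of_versalCharts` with its EGA IV 17 hypothesis fed the
tree THEOREM `EGAIV_etaleQuasiSection_of_liftsSmallExtensions_holds` ([EGAIV4] Prop. 17.14.2 + Cor. 17.16.3 (i),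
proved from Mathlib by seat lit-3). [cite: Lieblich2006, Thm. 4.2.1] [cite: EGAIV4, Prop. 17.14.2 and Cor. 17.16.3 (i)]
[cite: Perry2022, proof of Prop. 8.1] -/
theorem perfectLiftsAlgebraise_of_hasVersalPerfectChartAt [IsLocallyNoetherian S.left]
    (hV : ∀ (s₀ : ComplexPoints S) (X₀ : SchemeOver ℂ) (e : X₀ ≅ fiberOver π s₀)
      (E : CochainComplex X₀.left.Modules ℤ), IsBoundedVBComplex E →
      (∀ k : ℤ, k < 0 → extRank X₀ E k = 0) → HasVersalPerfectChartAt π s₀ X₀ e E) :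
    PerfectLiftsAlgebraise π :=
  perfectLiftsAlgebraise_of_versalCharts π EGAIV_etaleQuasiSection_of_liftsSmallExtensions_holds hV

end Glue

/-! ## §2 ASSEMBLY: versal charts ⟹ p7's `PerfectComplexAlgebraisesLifts C` (every `C`) ⟹ the g = 4 row -/

section Assembly

/-- **Lieblich-type versal charts on every smooth projective family over a smooth base ⟹
`PerfectComplexAlgebraisesLifts C` for EVERY Chern character theory `C`** (PROVED; EGA-free form of
`perfectComplexAlgebraisesLifts_of_versalCharts_of_EGA`, the EGA IV 17 input being the tree theorem
`EGAIV_etaleQuasiSection_of_liftsSmallExtensions_holds`; `HasVersalPerfectChartAt` has versality in EXISTENCE form,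
weaker than Lieblich's formal smoothness, which is not consumed — red-5 W-14). [cite: Lieblich2006, Thm. 4.2.1]
[cite: EGAIV4, Prop. 17.14.2 and Cor. 17.16.3 (i)] -/
theorem perfectComplexAlgebraisesLifts_of_versalCharts
    (hV : ∀ ⦃𝒳 S : SchemeOver ℂ⦄ (π : 𝒳 ⟶ S) (n : ℕ),
      IsSmoothProjectiveFamily π n → _root_.AlgebraicGeometry.Smooth S.hom →
      ∀ (s₀ : ComplexPoints S) (X₀ : SchemeOver ℂ) (e : X₀ ≅ fiberOver π s₀)
        (E : CochainComplex X₀.left.Modules ℤ), IsBoundedVBComplex E →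
        (∀ k : ℤ, k < 0 → extRank X₀ E k = 0) → HasVersalPerfectChartAt π s₀ X₀ e E)
    (C : ChernCharacterBetti) : PerfectComplexAlgebraisesLifts C :=
  perfectComplexAlgebraisesLifts_of_versalCharts_of_EGA EGAIV_etaleQuasiSection_of_liftsSmallExtensions_holds hV C

variable {C : ChernCharacterBetti}

/-- **g = 4, route (C), σ-TIER, trust base for the Hodge-free half = Lieblich-type versal charts ALONE.** BY NAME:
`weilFamilyReach_hyperbolic` (Deligne, refereed tree fact), `PridhamPerfectLifts C` ([Pridham2024Semiregularity]
Cor. 2.25 + Rem. 2.27, venture-typed by seat p7) and Lieblich-type versal charts (`HasVersalPerfectChartAt` for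
every universally gluable bounded complex of vector bundles on every smooth projective family over a smooth base —
the chart-level corollary of [Lieblich2006] Thm. 4.2.1, assumption by name; PRECISION (red-5 W-14): its versality
clause is typed in EXISTENCE form — implied by, and WEAKER than, formal smoothness of a Lieblich atlas at the chart
point, which is NOT consumed); EGA IV 17.14.2 / 17.16.3 (i) and the (D3)–(D5) glue are KERNEL. BY VALUE: verbatim
`weilFourfoldsSplit_of_reach_of_pridhamPerfect_of_versalCharts_of_EGA_of_complex` minus `hEGA`. Conclusion:
`Stubs.WeilAlgebraicSplitHyperplane 2 d` (in print: [Markman2023GeneralizedKummers] Thm. 1.5 (= Thm. 13.4; J. Eur. Math. Soc. 25 (2023) p. 236; pre-publication arXiv numbering: Thm. 1.3);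
re-derived, no new case). [cite: Markman2023GeneralizedKummers, Theorem 1.5 (= Theorem 13.4), p. 236 (the case in print; arXiv:1805.11574 pre-publication numbering: Theorem 1.3)]
[cite: Pridham2024Semiregularity, Cor. 2.25; Rem. 2.27] [cite: Lieblich2006, Thm. 4.2.1]
[cite: Deligne1982HodgeCycles, proof of Thm. 4.8] -/
theorem weilFourfoldsSplit_of_reach_of_pridhamPerfect_of_versalCharts_of_complex
    (hF : weilFamilyReach_hyperbolic) (hP : PridhamPerfectLifts C)
    (hV : ∀ ⦃𝒳 S : SchemeOver ℂ⦄ (π : 𝒳 ⟶ S) (n : ℕ),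
      IsSmoothProjectiveFamily π n → _root_.AlgebraicGeometry.Smooth S.hom →
      ∀ (s₀ : ComplexPoints S) (X₀ : SchemeOver ℂ) (e : X₀ ≅ fiberOver π s₀)
        (E : CochainComplex X₀.left.Modules ℤ), IsBoundedVBComplex E →
        (∀ k : ℤ, k < 0 → extRank X₀ E k = 0) → HasVersalPerfectChartAt π s₀ X₀ e E)
    {d : ℕ} (hd : 0 < d)
    (P : AbelianVariety ℂ) (ψ₀ : P ⟶ P) (e : ProjectiveEmbedding P.X) (a : complexBetti (projectiveSpace e.n ℂ) 2)
    (hP4 : P.dim = 2 * 2) (hψ : ψ₀ ≫ ψ₀ = -(d • 𝟙 P)) (ha : IsRationalClass a) (ha0 : a ≠ 0)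
    (hhyp : IsHyperbolicWeilType P ψ₀ 2 (symmetrisedClass d P ψ₀ e a))
    (w : complexBetti P.X (2 * 2)) (hwW : w ∈ weilClassesOf P ψ₀ 2 d) (hwr : IsRationalClass w) (hw0 : w ≠ 0)
    (I : Finset ℕ) (hI : ∀ p : ℕ, 1 ≤ p → p ≤ 2 * 2 → p ∈ I) (E : CochainComplex P.X.left.Modules ℤ)
    (hE : IsBoundedVBComplex E) (hneg : ∀ k : ℤ, k < 0 → extRank P.X E k = 0) (h0 : extRank P.X E 0 = 1)
    (a' b' : ℤ) [E.IsStrictlyGE a'] [E.IsStrictlyLE b']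
    (hσ : letI := HasDerivedCategory.standard P.X.left.Modules
      HomComplex.IsISemiregularC P.X E a' b' hE.isFiniteLocallyFree {q | q + 1 ∈ I})
    (q : ℚ) (c : ℕ → ℚ)
    (hch2 : chPerfect C P.X E hE.isFiniteLocallyFree 2 = ((q : ℚ) : ℂ) • cupPowTwo (symmetrisedClass d P ψ₀ e a) 2 + w)
    (hchp : ∀ p ∈ I, p ≠ 2 →
      chPerfect C P.X E hE.isFiniteLocallyFree p = ((c p : ℚ) : ℂ) • cupPowTwo (symmetrisedClass d P ψ₀ e a) p) :
    Stubs.WeilAlgebraicSplitHyperplane 2 d :=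
  weilFourfoldsSplit_of_reach_of_pridhamPerfect_of_versalCharts_of_EGA_of_complex hF hP
    EGAIV_etaleQuasiSection_of_liftsSmallExtensions_holds hV hd P ψ₀ e a hP4 hψ ha ha0 hhyp w hwW hwr hw0
    I hI E hE hneg h0 a' b' hσ q c hch2 hchp

end Assembly

/-! ## Audit: what is assumed, what is proved
ASSUMED BY NAME in §2's row: `weilFamilyReach_hyperbolic` (refereed), `PridhamPerfectLifts C` (printed + refereed
statement, venture-typed, undischarged), `HasVersalPerfectChartAt` for every universally gluable bounded complex of
vector bundles on every smooth projective family over a smooth base (seat corollary of [Lieblich2006] 4.2.1 whose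
versality clause is in EXISTENCE form — weaker than Lieblich's formal smoothness, which nothing here consumes (red-5
W-14) —, kernel-linked to nothing) — and the census object BY VALUE. PROVED (kernel): EGA IV₄ 17.14.2 / 17.16.3 (i)
(Literature theorem `EGAIV_etaleQuasiSection_of_liftsSmallExtensions_holds`), the (D3)–(D5) glue
(`AmplificationChainVersalChart.lean` §7), object ⟹ classes (`AmplificationChainEtaleFamily.lean`), p7's row.
NOT here: Lieblich's theorem itself (algebraic stack ⟹ smooth atlas ⟹ versal chart, formally smooth), HC_CM, CM
density, Mumford–Tate finiteness. -/

end Summit.Ventures.HSemireg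

end
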